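import Summits.QuantumFields.BalabanUV.T4Continuum.Support.B13StepTermFamily
import Summits.QuantumFields.BalabanUV.T4Continuum.Support.ActivityTermDatum

/-!
# NE5 ∕ U3 — JUNCTION: route P2's (2.14)-term model `ActivityTermDatum.TermDatum` with a ℂ-LINEAR history read-out IS
# exp-linear in the history species ⟹ the Ursell term family built on such activity terms (`B13StepTermFamily.term`)
# satisfies `TermHistExpLinear` with exhibited data (row O1-d2, second file)

Cell `pub-balaban`, unit `b2b-balaban-t4-ne5-formalise-leaf-08` (NE5 formalisation swarm, LEAF PROVER 08; row O1-d2 of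
`t4/b2b-balaban-t4-ne5-p1/O1-CLAIM-TABLE-NE5-P1.md`, companion of `Support/B13StepTermFamily.lean` p207797).  Summits-side NEW
WORK under the LEAN PLACEMENT RULE (cell modelling + bookkeeping).  HONEST FRAMING: rung (B)+1 of the FINITE-VOLUME T⁴ continuum
programme — NOT infinite volume, NOT a mass gap, NOT the Clay problem, NOT a proof of NE5 (NOT PRINTED: the series prints ε-UNIFORM
bounds, never η-RATES).  HONEST DEPENDENCY (cell line, verbatim): continuum YM on T⁴ ⇐ BetaPertH ∧ nine spine estimates (0/9
proved); BetaPertH ⇐ (D1) ∧ (D4) ∧ CAP+tail; G-an2-4 gates asym, D1 and NE2/3/4.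

WHY.  The owner's design (`B13StepDesign.md` v0.2, Q1 answer) fixes ONE operator datum read by BOTH kernel routes: the resummed
terms (2.14) of [Balaban1988RG2Cluster] p. 15 are typed ONCE, in route P2's format `TermDatum` (p195577; the term
`z(o)⁻¹ • ∫ exp(−(opForm o x + histForm h x)) • F₀ x dν`, kernels `kP∕kA∕kL∕kQ∕kR` read from `o`, the earlier actions through
`read h Y x` under the printed `τ(Y)`-weights — (1.23) p. 7, (1.33) p. 9, (2.14) p. 15 for KIND), and route P1 (`StepModel.Out`)
reads them as ACTIVITY TERMS `act Z j o h := (𝔱 Z j).term (o, h)` of the Ursell family `B13StepTermFamily.term` (p207797).  Row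
O1-c (`B13HistDatum`, p207748) types the history read-outs as continuous ℂ-linear functionals (`potCLM`), i.e. the case
`read h Y x = L Y x h` of `ActivityTermModel.read_of_clm` (p206862's `readLip_of_linear_clm`).  In that case every term IS
`∫ Φ(o,x)·exp(Λ(x) h) dν` with the HISTORY-FREE weight `Φ(o,x) = z(o)⁻¹·e^{−opForm o x}·F₀(x)` and the continuous linear functional
`Λ(x) = −Σ_{Y∈𝐃} τ(Y)•L Y x` — the hypothesis shape `B13StepTermFamily.ActExpLinearOn` — so `termHistExpLinear_of_actExpLinear`
fires: the history half of W2 (leaf L04) is STRUCTURAL for every instance of rows O1-b∕c∕d typed this way.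

WHAT IS PROVED (kernel; nothing about Bałaban's objects is asserted — every input is DATA or a displayed one-run hypothesis):
* §1 one term: `histCLM 𝔱 L x`, `weight 𝔱 o x`; `histForm_eq_neg_histCLM`, `term_eq_integral_weight_cexp` (the exp-linear FORM,
  by `integral_const_mul`); `norm_histCLM_le` (operator norm ≤ (Σ_{Y∈𝐃} v(Y))/ϱ from P2's one-run shape `ReadUnitBound`, BY NAME);
  `integrable_weight` (from `Integrable (F (o,h)) ν` at ANY history `h` — P2's `RefAt.hF` at the class point — the history tilt
  being bounded by `exp(‖h‖·(Σ v)/ϱ)` uniformly in `x`).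
* §2 the family: `actOf 𝔱`, `dataOf 𝔱 L : ActData`, hypothesis shape `LinearHistoryOn` (= read-out IS a CLM family + `ReadUnitBound`
  + σ-finite term measures + measurable history exponents + `RefAt.hF` at class points of the localizing tuples' factors), and
  `actExpLinearOn_of_linearHistory`, hence `termHistExpLinear_of_linearHistory` ∕ `termHistLineAnalytic_of_linearHistory`
  (the leaf's shapes for `term 𝒯 inc (actOf 𝔱)`, BY NAME).
NOT CLAIMED: no estimate (no `TermBound`∕`TermBudget`∕operator half); no instance on Bałaban's objects (rows O1-a∕e pending); the
identification of (2.13)'s ordered-tuple form with the Kotecký–Preiss form stays the recorded junction question.  0 sorry;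
axioms ⊆ {propext, Classical.choice, Quot.sound}.
-/

noncomputable section

open MeasureTheory
open scoped BigOperators

namespace Summit.QuantumFields.BalabanUV.T4Continuum.B13StepTermExpLinear

open Literature.MathematicalPhysics.QuantumFieldTheory.Balaban1983to89.T4OutputRate (Carriers)
open Literature.MathematicalPhysics.QuantumFieldTheory.Balaban1983to89.T4InputCauchyRateTermwise
  (TermHistExpLinear TermHistLineAnalytic)
open Literature.MathematicalPhysics.QuantumFieldTheory.Balaban1983to89.T4ActivityTiltHistory (histPot ReadUnitBound)
open Summit.QuantumFields.BalabanUV.T4Continuum.ActivityTermModel (TermDatum)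
open Summit.QuantumFields.BalabanUV.T4Continuum.B13StepTermFamily
  (TermIndexing ActData ActExpLinearOn term tupleMeasure tupleWeight tupleFunctional termHistExpLinear_of_actExpLinear
    termHistLineAnalytic_of_actExpLinear)

variable {Op Hist ι κ S Ω Ω₀ 𝒴 𝒞 : Type*} [MeasurableSpace Ω] [MeasurableSpace Ω₀] [NormedAddCommGroup Hist]
  [NormedSpace ℂ Hist]

/-! ## §1 One (2.14)-term with a ℂ-linear history read-out is exp-linear in the history -/

section OneTerm

variable (𝔱 : TermDatum Op Hist ι κ S Ω Ω₀ 𝒴 𝒞) (L : 𝒴 → Ω → (Hist →L[ℂ] ℂ))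

/-- [folklore] The continuous linear HISTORY FUNCTIONAL of the term at the integration point `x`:
`Λ(x) = −Σ_{Y∈𝐃} τ(Y) • L Y x` (minus the `τ`-weighted sum of the read-out functionals — the exponent of (2.14)'s last factor). -/
def histCLM (x : Ω) : Hist →L[ℂ] ℂ := -∑ Y ∈ 𝔱.D, 𝔱.τ Y • L Y x

variable {𝔱 L}

/-- [folklore] Applying the history functional: `Λ(x) h = −Σ_{Y∈𝐃} τ(Y)·(L Y x h)`. -/
theorem histCLM_apply (x : Ω) (h : Hist) : histCLM 𝔱 L x h = -∑ Y ∈ 𝔱.D, 𝔱.τ Y * L Y x h := by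
  simp [histCLM, _root_.sum_apply]

/-- [folklore] With a linear read-out (`read h Y x = L Y x h`) the history exponent IS minus the functional: `histForm h x = −Λ(x) h`. -/
theorem histForm_eq_neg_histCLM (hread : ∀ h Y x, 𝔱.read h Y x = L Y x h) (h : Hist) (x : Ω) :
    𝔱.histForm h x = -(histCLM 𝔱 L x h) := by
  rw [histCLM_apply, neg_neg]
  unfold TermDatum.histForm histPot
  exact Finset.sum_congr rfl fun Y _ => by simp only [hread]

/-- [folklore] The operator norm of the history functional from P2's one-run shape `ReadUnitBound` (BY NAME):
`‖Λ(x)‖ ≤ (Σ_{Y∈𝐃} v(Y))/ϱ`, uniformly in the integration point. -/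
theorem norm_histCLM_le (hread : ∀ h Y x, 𝔱.read h Y x = L Y x h) {ϱ : ℝ} (hϱ : 0 < ϱ)
    (hv : ∀ Y ∈ 𝔱.D, 0 ≤ 𝔱.v Y) (hunit : ReadUnitBound 𝔱.read 𝔱.D 𝔱.τ 𝔱.v ϱ) (x : Ω) :
    ‖histCLM 𝔱 L x‖ ≤ (∑ Y ∈ 𝔱.D, 𝔱.v Y) / ϱ := by
  refine ContinuousLinearMap.opNorm_le_bound _ (div_nonneg (Finset.sum_nonneg hv) hϱ.le) fun h => ?_
  rw [histCLM_apply, norm_neg]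
  calc ‖∑ Y ∈ 𝔱.D, 𝔱.τ Y * L Y x h‖ ≤ ∑ Y ∈ 𝔱.D, ‖𝔱.τ Y * L Y x h‖ := norm_sum_le _ _
    _ ≤ ∑ Y ∈ 𝔱.D, ‖h‖ / ϱ * 𝔱.v Y := Finset.sum_le_sum fun Y hY => by rw [← hread]; exact hunit h Y hY x
    _ = (∑ Y ∈ 𝔱.D, 𝔱.v Y) / ϱ * ‖h‖ := by rw [← Finset.mul_sum]; ring

/-- [folklore] Pointwise bound of the un-tilting factor at history `h`: `‖exp(−Λ(x) h)‖ ≤ exp(‖h‖·(Σ v)/ϱ)`. -/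
theorem norm_cexp_neg_histCLM_le (hread : ∀ h Y x, 𝔱.read h Y x = L Y x h) {ϱ : ℝ} (hϱ : 0 < ϱ)
    (hv : ∀ Y ∈ 𝔱.D, 0 ≤ 𝔱.v Y) (hunit : ReadUnitBound 𝔱.read 𝔱.D 𝔱.τ 𝔱.v ϱ) (h : Hist) (x : Ω) :
    ‖Complex.exp (-(histCLM 𝔱 L x h))‖ ≤ Real.exp (‖h‖ * ((∑ Y ∈ 𝔱.D, 𝔱.v Y) / ϱ)) := by
  rw [Complex.norm_exp]
  refine Real.exp_le_exp.2 ?_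
  calc (-(histCLM 𝔱 L x h)).re ≤ ‖-(histCLM 𝔱 L x h)‖ := Complex.re_le_norm _
    _ = ‖histCLM 𝔱 L x h‖ := norm_neg _
    _ ≤ ‖histCLM 𝔱 L x‖ * ‖h‖ := (histCLM 𝔱 L x).le_opNorm h
    _ ≤ (∑ Y ∈ 𝔱.D, 𝔱.v Y) / ϱ * ‖h‖ := mul_le_mul_of_nonneg_right (norm_histCLM_le hread hϱ hv hunit x) (norm_nonneg _)
    _ = ‖h‖ * ((∑ Y ∈ 𝔱.D, 𝔱.v Y) / ϱ) := mul_comm _ _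

variable [Fintype ι] [Fintype κ] [DecidableEq ι] [DecidableEq κ]

variable (𝔱) in
/-- [folklore] The HISTORY-FREE WEIGHT of the term at operator point `o`: `Φ(o,x) = z(o)⁻¹ · e^{−opForm o x} · F₀(x)`. -/
def weight (o : Op) (x : Ω) : ℂ := (𝔱.z o)⁻¹ * (Complex.exp (-𝔱.opForm o x) * 𝔱.F₀ x)

/-- [folklore] The tilted integrand factorises: `F (o,h) x = (e^{−opForm o x}·F₀ x) · exp(Λ(x) h)`. -/
theorem F_eq_mul_cexp (hread : ∀ h Y x, 𝔱.read h Y x = L Y x h) (o : Op) (h : Hist) (x : Ω) :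
    𝔱.F (o, h) x = Complex.exp (-𝔱.opForm o x) * 𝔱.F₀ x * Complex.exp (histCLM 𝔱 L x h) := by
  unfold TermDatum.F
  rw [smul_eq_mul, histForm_eq_neg_histCLM hread, neg_add, neg_neg, Complex.exp_add]
  ring

/-- [folklore] Conversely the history-free part is the tilted integrand UN-tilted: `e^{−opForm}·F₀ = exp(−Λ(x) h) · F (o,h) x`. -/
theorem expOp_mul_F₀_eq (hread : ∀ h Y x, 𝔱.read h Y x = L Y x h) (o : Op) (h : Hist) (x : Ω) :
    Complex.exp (-𝔱.opForm o x) * 𝔱.F₀ x = Complex.exp (-(histCLM 𝔱 L x h)) * 𝔱.F (o, h) x := by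
  rw [F_eq_mul_cexp hread, mul_comm (Complex.exp (-(histCLM 𝔱 L x h))), mul_assoc, ← Complex.exp_add, add_neg_cancel,
    Complex.exp_zero, mul_one]

/-- [folklore] **THE EXP-LINEAR FORM OF ONE TERM**: `term (o,h) = ∫ Φ(o,x) · exp(Λ(x) h) dν`. -/
theorem term_eq_integral_weight_cexp (hread : ∀ h Y x, 𝔱.read h Y x = L Y x h) (o : Op) (h : Hist) :
    𝔱.term (o, h) = ∫ x, weight 𝔱 o x * Complex.exp (histCLM 𝔱 L x h) ∂𝔱.ν := by
  unfold TermDatum.term weight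
  rw [smul_eq_mul, ← integral_const_mul]
  refine integral_congr_ae (Filter.Eventually.of_forall fun x => ?_)
  show (𝔱.z o)⁻¹ * 𝔱.F (o, h) x = (𝔱.z o)⁻¹ * (Complex.exp (-𝔱.opForm o x) * 𝔱.F₀ x) * Complex.exp (histCLM 𝔱 L x h)
  rw [F_eq_mul_cexp hread]; ring

/-- [folklore] **THE WEIGHT IS INTEGRABLE** as soon as the tilted integrand is integrable at SOME history `h` (P2's `RefAt.hF` at
the class point) and the history exponent is measurable (P2's `Geometry.hhistm`): un-tilting costs a factor bounded uniformly
in `x` (`norm_cexp_neg_histCLM_le`). -/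
theorem integrable_weight (hread : ∀ h Y x, 𝔱.read h Y x = L Y x h) {ϱ : ℝ} (hϱ : 0 < ϱ) (hv : ∀ Y ∈ 𝔱.D, 0 ≤ 𝔱.v Y)
    (hunit : ReadUnitBound 𝔱.read 𝔱.D 𝔱.τ 𝔱.v ϱ) {o : Op} {h : Hist} (hF : Integrable (𝔱.F (o, h)) 𝔱.ν)
    (hhistm : AEStronglyMeasurable (fun x => 𝔱.histForm h x) 𝔱.ν) : Integrable (weight 𝔱 o) 𝔱.ν := by
  have hmeas : AEStronglyMeasurable (fun x => Complex.exp (-(histCLM 𝔱 L x h))) 𝔱.ν := by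
    have : (fun x => Complex.exp (-(histCLM 𝔱 L x h))) = fun x => Complex.exp (𝔱.histForm h x) :=
      funext fun x => by rw [histForm_eq_neg_histCLM hread]
    rw [this]
    exact Complex.continuous_exp.comp_aestronglyMeasurable hhistm
  have hprod : Integrable (fun x => Complex.exp (-(histCLM 𝔱 L x h)) * 𝔱.F (o, h) x) 𝔱.ν :=
    hF.bdd_mul hmeas (Filter.Eventually.of_forall fun x => norm_cexp_neg_histCLM_le hread hϱ hv hunit h x)
  have heq : weight 𝔱 o = fun x => (𝔱.z o)⁻¹ * (Complex.exp (-(histCLM 𝔱 L x h)) * 𝔱.F (o, h) x) :=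
    funext fun x => by rw [weight, expOp_mul_F₀_eq hread o h x]
  rw [heq]
  exact hprod.const_mul _

end OneTerm

/-! ## §2 The family: P2 term data with linear history read-outs feed `ActExpLinearOn`, hence `TermHistExpLinear` -/

section Family

variable [Fintype ι] [Fintype κ] [DecidableEq ι] [DecidableEq κ] {C : Carriers} {ιT P J : Type*} (𝒯 : TermIndexing C ιT P J) (inc : P → P → Prop) [DecidableRel inc]
  (𝔱 : P → J → TermDatum Op Hist ι κ S Ω Ω₀ 𝒴 𝒞) (L : P → J → 𝒴 → Ω → (Hist →L[ℂ] ℂ)) (ϱ : P → J → ℝ)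

/-- [folklore] THE ACTIVITY TERMS READ FROM THE TERM DATA: `act Z j o h := (𝔱 Z j).term (o, h)`. -/
def actOf : P → J → Op → Hist → ℂ := fun Z j o h => (𝔱 Z j).term (o, h)

/-- [folklore] THE EXHIBITED EXP-LINEAR DATA of the family: the terms' own measures, the history-free weights, the history
functionals (operator-point independent). -/
def dataOf : ActData P J Op Hist Ω where
  ν Z j _ := (𝔱 Z j).ν
  Φ Z j o x := weight (𝔱 Z j) o x
  Λ Z j _ x := histCLM (𝔱 Z j) (L Z j) x

/-- [folklore] HYPOTHESIS SHAPE `LinearHistoryOn` (STRUCTURE + one-run KIND, asserted nowhere): every term's history read-out IS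
the continuous linear family `L` ([Balaban1988RG2Cluster] (1.23) p. 7, (1.33) p. 9: the earlier actions enter linearly), obeys
P2's `ReadUnitBound` with a positive margin and nonnegative weights, has a σ-finite measure and measurable history exponents
(P2's `Geometry.hhistm`), and — at every class point `q` of step `k`, for every factor of every tuple localizing at a step-`k`
domain — an integrable tilted integrand (P2's `RefAt.hF`, the one-run integrability of (2.15) p. 15). -/
@[folklore]
structure LinearHistoryOn (K : ℕ → (ℕ → ℝ) → C.BgB → Set (Op × Hist)) (W : Set (ℕ → ℝ)) : Prop where
  read : ∀ Z j (h : Hist) (Y : 𝒴) (x : Ω), (𝔱 Z j).read h Y x = L Z j Y x h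
  pos : ∀ Z j, 0 < ϱ Z j
  nonneg : ∀ Z j, ∀ Y ∈ (𝔱 Z j).D, 0 ≤ (𝔱 Z j).v Y
  unit : ∀ Z j, ReadUnitBound (𝔱 Z j).read (𝔱 Z j).D (𝔱 Z j).τ (𝔱 Z j).v (ϱ Z j)
  sigmaFinite : ∀ Z j, SigmaFinite (𝔱 Z j).ν
  histm : ∀ Z j (y : Hist), AEStronglyMeasurable (fun x => (𝔱 Z j).histForm y x) (𝔱 Z j).ν
  refF : ∀ k, ∀ g ∈ W, ∀ (U : C.BgB) (q : Op × Hist), q ∈ K k g U → ∀ X : C.Dom, C.scale X = k →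
    ∀ i, 𝒯.Rel k i X → ∀ m, Integrable ((𝔱 (𝒯.poly i m) (𝒯.lab i m)).F q) (𝔱 (𝒯.poly i m) (𝒯.lab i m)).ν

variable {𝒯 𝔱 L ϱ}

/-- [folklore] **P2 TERM DATA WITH LINEAR HISTORY READ-OUTS ARE EXP-LINEAR ACTIVITY TERMS** (`ActExpLinearOn` of p207797, with
the data `dataOf 𝔱 L`). -/
theorem actExpLinearOn_of_linearHistory {K : ℕ → (ℕ → ℝ) → C.BgB → Set (Op × Hist)} {W : Set (ℕ → ℝ)}
    (hL : LinearHistoryOn 𝒯 𝔱 L ϱ K W) : ActExpLinearOn 𝒯 (actOf 𝔱) (dataOf 𝔱 L) K W where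
  sigmaFinite _ _ _ _ _ _ _ _ i _ m := hL.sigmaFinite (𝒯.poly i m) (𝒯.lab i m)
  integrable k g hg U q hq X hX i hi m :=
    integrable_weight (hL.read _ _) (hL.pos _ _) (hL.nonneg _ _) (hL.unit _ _) (hL.refF k g hg U q hq X hX i hi m)
      (hL.histm _ _ q.2)
  measurable _ _ _ _ q _ _ _ i _ m y := by
    have h := (hL.histm (𝒯.poly i m) (𝒯.lab i m) y).neg
    refine h.congr (Filter.Eventually.of_forall fun x => ?_)
    show -((𝔱 (𝒯.poly i m) (𝒯.lab i m)).histForm y x) = histCLM _ (L (𝒯.poly i m) (𝒯.lab i m)) x y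
    rw [histForm_eq_neg_histCLM (hL.read _ _), neg_neg]
  bounded _ _ _ _ q _ _ _ i _ m :=
    ⟨(∑ Y ∈ (𝔱 (𝒯.poly i m) (𝒯.lab i m)).D, (𝔱 (𝒯.poly i m) (𝒯.lab i m)).v Y) / ϱ (𝒯.poly i m) (𝒯.lab i m),
      Filter.Eventually.of_forall fun x => norm_histCLM_le (hL.read _ _) (hL.pos _ _) (hL.nonneg _ _) (hL.unit _ _) x⟩
  repr _ _ _ _ q _ _ _ i _ m := term_eq_integral_weight_cexp (hL.read _ _) q.1 q.2

/-- [folklore] **… HENCE THE URSELL TERM FAMILY ON THEM IS EXP-LINEAR IN THE HISTORY WITH EXHIBITED (μ, Φ, Λ)** — the termwise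
leaf's `TermHistExpLinear` for `term 𝒯 inc (actOf 𝔱)` (data: product measures of the terms' `ν`, 𝟙·coefficient·Π `weight`,
𝟙·Σ `histCLM`), by `termHistExpLinear_of_actExpLinear` (p207797). -/
theorem termHistExpLinear_of_linearHistory {K : ℕ → (ℕ → ℝ) → C.BgB → Set (Op × Hist)} {W : Set (ℕ → ℝ)}
    (hL : LinearHistoryOn 𝒯 𝔱 L ϱ K W) :
    TermHistExpLinear K (term 𝒯 inc (actOf 𝔱)) W (α := fun _ i => Fin (𝒯.len i + 1) → Ω)
      (fun _ i o _ => tupleMeasure 𝒯 (dataOf 𝔱 L) i o) (fun k i o X => tupleWeight 𝒯 inc (dataOf 𝔱 L) k i o X)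
      (fun k i o X => tupleFunctional 𝒯 (dataOf 𝔱 L) k i o X) :=
  termHistExpLinear_of_actExpLinear (actExpLinearOn_of_linearHistory hL)

/-- [folklore] **… AND EVERY URSELL TERM IS ANALYTIC ALONG EVERY HISTORY LINE IN THE CLASS, WITH NO ANALYTICITY HYPOTHESIS**
(`TermHistLineAnalytic`, the history half of leaf L04's termwise input). -/
theorem termHistLineAnalytic_of_linearHistory {K : ℕ → (ℕ → ℝ) → C.BgB → Set (Op × Hist)} {W : Set (ℕ → ℝ)}
    (hL : LinearHistoryOn 𝒯 𝔱 L ϱ K W) : TermHistLineAnalytic K (term 𝒯 inc (actOf 𝔱)) W :=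
  termHistLineAnalytic_of_actExpLinear (inc := inc) (actExpLinearOn_of_linearHistory hL)

end Family

end Summit.QuantumFields.BalabanUV.T4Continuum.B13StepTermExpLinear

end
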